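import Literature.Analysis.FluidPDE.LerayHopfRegularRestart
import Literature.Analysis.FluidPDE.LocalEnergySolutionsRescaling
import Literature.Analysis.FluidPDE.JiaSverak2014SlabAprioriEstimate
import Literature.Analysis.FluidPDE.NSSereginMildProp151
import Literature.Analysis.FluidPDE.KatoLocalCovariance
import HarnessLib

/-!
# Seregin's `L³` blow-up criterion for energy solutions, §2: the rescaled energy solution as a
# family of local energy solutions up to the blow-up time (Seregin 2012, §2, (2.3)–(2.4))

Analysis/FluidPDE proof file (theorems only: no definition, no named fact, no `sorry`) on the
line of the named fact `Literature.Analysis.FluidPDE.seregin_L3_blowup` (`NSLerayHopf.lean`,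
**ns.S08**; G. Seregin, *A certain necessary condition of potential blow up for Navier–Stokes
equations*, Comm. Math. Phys. 312 (2012) 833–845 = arXiv:1104.3615, **Thm. 1.1**).

Seregin's own proof (§2, p. 3 of the arXiv version) does **not** construct the approximating
sequence by an existence theorem: "Let us scale `v` and `q` so that
`u^{(k)}(y,s) = λ_k v(x,t)`, `p^{(k)}(y,s) = λ_k² q(x,t)`, `x = λ_k y`, `t = T + λ_k² s`,
`λ_k = √((T − t_k)/S)` … By the scale invariance of `L₃`-norm, `u^{(k)}(·,−S)` is uniformly
bounded in `L₃(ℝ³)`" — the approximants are the rescaled restrictions of the *given* energy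
solution to the strips `ℝ³ × ]t_k, T[` ending **at the blow-up time**, and they are local energy
solutions there because an energy solution which is regular before `T` is one (§3, p. 5: "By
definition accepted in [KS], the pair `u` and `p` … is a local energy solution"; Seregin, *Lecture
notes* (2014), Ch. 7, proof of Thm. 1.1 (= Thm. 7.1.?) pp. 130–138, verbatim). This file supplies
that step for the tree's **ns.S08** hypotheses (a Leray–Hopf solution on `[0, T)`, classical on
`[0, T)`, essentially bounded on closed sub-strips):

* `IsLerayHopfOn.exists_isLocalEnergySolutionOn_restart` — **restarting a Leray–Hopf solution on
  `[0, T)`, regular on the open strip, at `t₀ ∈ (0, T)` as a local energy solution on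
  `ℝ³ × (0, T − t₀)`** in Seregin's class `IsLocalEnergySolutionOn` (Def. B.1 = Kang–Miura–Tsai
  Def. 3.1), *up to the final time*. This is the tree's
  `IsGlobalLerayHopf.exists_isLocalEnergySolutionOn_restart` (`LerayHopfRegularRestart.lean`,
  Barker–Prange 2020 §4.2) with its hypothesis "global Leray–Hopf" replaced by the only thing its
  proof uses, the Leray–Hopf class on `[0, T)`; the proof is repeated verbatim (associated
  pressure `IsLerayHopfOn.exists_associated_pressure`, suitability from local boundedness glued
  along an exhaustion, energy inequality, weak continuity on `(0, T]`, `L²_loc`-attainment of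
  the datum at the regular time `t₀`, decay of `L²` slices).
* `isRegularPoint_of_eLpNorm_Icc_lt_top` — the points of the open strip are regular when `u` is
  essentially bounded on the closed sub-strips `[0, T'] × ℝ³` (the **ns.S08** hypothesis `hbdd`).

## References

* G. Seregin, Comm. Math. Phys. 312 (2012) 833–845 = arXiv:1104.3615, §2 (2.3)–(2.4), §3 p. 5.
  [Seregin2012CMP]
* G. Seregin, *Lecture Notes on Regularity Theory for the Navier–Stokes Equations*, World
  Scientific (2014), Ch. 7, Thm. 1.1 and its proof; App. B, Def. B.1, Remark B.4. [Seregin2014]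
* T. Barker, C. Prange, Arch. Ration. Mech. Anal. 236 (2020) = arXiv:1812.09115, §4.2.
  [BarkerPrange2020]
-/

noncomputable section

open MeasureTheory TopologicalSpace Set Function Filter Metric
open _root_.Topology
open scoped ENNReal NNReal RealInnerProductSpace

namespace Literature.Analysis.FluidPDE

/-! ### Regular points of the open strip -/

/-- **Boundedness on closed sub-strips makes every point of the open strip regular**: if
`u` is essentially bounded on `[0, T'] × ℝ³` for every `T' ∈ (0, T)`, then every `(t, x)`,
`0 < t < T`, is a regular point of `u` (the centred cylinder `Q*_r(t, x)` with
`r² < min(t, T − t)/2` lies in such a sub-strip). [folklore] -/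
theorem isRegularPoint_of_eLpNorm_Icc_lt_top {T : ℝ}
    {u : ℝ → EuclideanSpace ℝ (Fin 3) → EuclideanSpace ℝ (Fin 3)}
    (hbdd : ∀ T' ∈ Ioo 0 T, eLpNorm (uncurry u) ∞ (volume.restrict (Icc 0 T' ×ˢ univ)) < ∞)
    {t : ℝ} (ht : t ∈ Ioo 0 T) (x : EuclideanSpace ℝ (Fin 3)) : IsRegularPoint u (t, x) := by
  -- a radius with `r² < t` and `t + r² < T`
  set m : ℝ := min t (T - t) with hm
  have hmpos : 0 < m := lt_min ht.1 (by linarith [ht.2])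
  set r : ℝ := Real.sqrt (m / 2) with hr
  have hrpos : 0 < r := Real.sqrt_pos.2 (by positivity)
  have hr2 : r ^ 2 = m / 2 := by rw [hr, Real.sq_sqrt (by positivity)]
  have h1 : r ^ 2 < t := by rw [hr2]; linarith [min_le_left t (T - t)]
  have h2 : t + r ^ 2 < T := by rw [hr2]; linarith [min_le_right t (T - t)]
  set T' : ℝ := t + r ^ 2 with hT'
  have hT'I : T' ∈ Ioo 0 T := ⟨add_pos_of_pos_of_nonneg ht.1 (sq_nonneg r), h2⟩
  refine ⟨r, hrpos, lt_of_le_of_lt (eLpNorm_mono_measure _ (Measure.restrict_mono ?_ le_rfl))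
    (hbdd T' hT'I)⟩
  intro z hz
  rw [parabolicCylinderCentered, mem_prod] at hz
  exact ⟨⟨by linarith [hz.1.1], by linarith [hz.1.2]⟩, mem_univ _⟩

/-! ### Restarting a Leray–Hopf solution on `[0, T)` as a local energy solution -/

/-- **Restarting a Leray–Hopf solution on `[0, T)`, regular on the open strip `(0, T)`, at a time
`t₀ ∈ (0, T)` as a local energy solution up to the final time** (Seregin 2012, §3, p. 5: the
restricted energy solution "is a local energy solution" in the sense of Kikuchi–Seregin; the step
implicit in Barker–Prange 2020, §4.2). Let `u` be a Leray–Hopf weak solution of the unforced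
Navier–Stokes equations on `ℝ³ × [0, T)` with viscosity `ν > 0`, all of whose points `(t, x)`,
`0 < t < T`, are regular. Then for `t₀ ∈ (0, T)`, with `π(s) = p(t₀ + s)` the translated
associated pressure (`IsLerayHopfOn.exists_associated_pressure`), `(u(t₀ + ·), π)` is a local
energy solution on `ℝ³ × (0, T - t₀)` with datum `u(t₀)`. The proof is that of the tree's
`IsGlobalLerayHopf.exists_isLocalEnergySolutionOn_restart` (`LerayHopfRegularRestart.lean`), which
uses its global hypothesis only through the Leray–Hopf class on `[0, T)`.
[cite: Seregin2012CMP, §3 p. 5 (with §2 (2.3))] [cite: BarkerPrange2020, §4.2 (arXiv:1812.09115 p. 16)] [cite: Seregin2014, App. B Def. B.1, Remark B.4] -/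
theorem IsLerayHopfOn.exists_isLocalEnergySolutionOn_restart {ν T : ℝ} (hν : 0 < ν) (hT : 0 < T)
    {u₀ : EuclideanSpace ℝ (Fin 3) → EuclideanSpace ℝ (Fin 3)}
    {u : ℝ → EuclideanSpace ℝ (Fin 3) → EuclideanSpace ℝ (Fin 3)}
    (hLHT : IsLerayHopfOn T ν 0 u₀ u)
    (hreg : ∀ t ∈ Ioo 0 T, ∀ x : EuclideanSpace ℝ (Fin 3), IsRegularPoint u (t, x))
    {t₀ : ℝ} (ht₀ : t₀ ∈ Ioo 0 T) :
    ∃ π : ℝ → EuclideanSpace ℝ (Fin 3) → ℝ,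
      IsLocalEnergySolutionOn (T - t₀) ν (u t₀) (fun s => u (t₀ + s)) π := by
  -- the associated pressure on the strip `(0, T) × ℝ³`
  obtain ⟨p, hp32, hNS, -⟩ := hLHT.exists_associated_pressure hT
  have htoReal : ((3 / 2 : ℝ≥0∞)).toReal = (3 / 2 : ℝ) := by
    rw [ENNReal.toReal_div, ENNReal.toReal_ofNat, ENNReal.toReal_ofNat]
  have hpslab : ∫⁻ z in Ioo 0 T ×ˢ (univ : Set (EuclideanSpace ℝ (Fin 3))),
      ‖p z.1 z.2‖ₑ ^ (3 / 2 : ℝ) < ∞ := by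
    have h := lintegral_rpow_enorm_lt_top_of_eLpNorm_lt_top (by norm_num)
      (ENNReal.div_ne_top (by norm_num) (by norm_num)) hp32.eLpNorm_lt_top
    rw [htoReal] at h
    exact h
  have hpK : ∀ K ⊆ ((slab (EuclideanSpace ℝ (Fin 3)) (Ioo 0 T) isOpen_Ioo :
      Opens (ℝ × EuclideanSpace ℝ (Fin 3))) : Set (ℝ × EuclideanSpace ℝ (Fin 3))),
      IsCompact K → ∫⁻ z in K, ‖p z.1 z.2‖ₑ ^ (3 / 2 : ℝ) < ∞ :=
    fun K hK _ => lt_of_le_of_lt (lintegral_mono_set hK) hpslab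
  -- times of the restarted interval
  have hIcc : ∀ {s : ℝ}, s ∈ Icc 0 (T - t₀) → t₀ + s ∈ Icc 0 T := fun hs =>
    ⟨by linarith [hs.1, ht₀.1], by linarith [hs.2]⟩
  -- the every-time energy bound `∫ |u(t)|² ≤ 2 E(u₀)`
  have henergy : ∀ t ∈ Icc 0 T, eEnergy (u t) ≤ ENNReal.ofReal (2 * VectorCalculus.kineticEnergy u₀) := by
    obtain ⟨G, -, -, hE, -⟩ := hLHT.weakGrad_energy
    intro t ht
    have hE' : VectorCalculus.kineticEnergy (u t) +
        ν * (∫⁻ τ in Ioo 0 t, ∫⁻ x, ENNReal.ofReal (frobeniusNormSq (G τ x))).toReal ≤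
          VectorCalculus.kineticEnergy u₀ := by simpa using hE t ht
    have hD : 0 ≤ ν * (∫⁻ τ in Ioo 0 t, ∫⁻ x, ENNReal.ofReal (frobeniusNormSq (G τ x))).toReal :=
      mul_nonneg hν.le ENNReal.toReal_nonneg
    rw [hLHT.eEnergy_eq ht]
    exact ENNReal.ofReal_le_ofReal (by linarith)
  -- weak continuity on the restarted closed interval
  have hwcI : ∀ w : EuclideanSpace ℝ (Fin 3) → EuclideanSpace ℝ (Fin 3), MemLp w 2 volume →
      ContinuousOn (fun t => ∫ y, ⟪u t y, w y⟫) (Ioc 0 T) := fun w hw => (hLHT.weak_continuous w hw).1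
  refine ⟨fun s y => p (t₀ + s) y,
    { suitable := ?_
      pressure := ?_
      sliceMeasurable := ?_
      uniformLocalEnergy := ?_
      uniformLocalGradient := ?_
      weakContinuous := ?_
      initial := ?_
      decay := ?_ }⟩
  · -- (B.1.5), (B.1.8): suitability on the strip `(t₀, T)`, glued from bounded boxes, translated
    obtain ⟨Qn, hle, hmono, hcov, hbox⟩ := exists_box_exhaustion ht₀.1 ht₀.2
    have hsuit : IsSuitableWeakSolutionOn (slab (EuclideanSpace ℝ (Fin 3)) (Ioo t₀ T) isOpen_Ioo) ν 0 u p := by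
      refine IsSuitableWeakSolutionOn.of_exhaustion hle hmono hcov fun n => ?_
      obtain ⟨a, b, R, ha, hb, hab, hQ⟩ := hbox n
      have hleT : Qn n ≤ slab (EuclideanSpace ℝ (Fin 3)) (Ioo 0 T) isOpen_Ioo := by
        intro z hz
        have hz' : z ∈ Ioo a b ×ˢ ball (0 : EuclideanSpace ℝ (Fin 3)) R := by
          rw [← hQ]; exact hz
        exact mem_slab.2 ⟨ha.trans hz'.1.1, hz'.1.2.trans hb⟩
      have hNSn : IsDistributionalNSSolutionOn (Qn n) ν 0 u p :=
        IsDistributionalNSSolutionOn.mono_holds hNS hleT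
      have hvol : volume ((Qn n : Opens (ℝ × EuclideanSpace ℝ (Fin 3))) : Set (ℝ × EuclideanSpace ℝ (Fin 3))) < ∞ := by
        rw [hQ, Measure.volume_eq_prod, Measure.prod_prod]
        exact ENNReal.mul_lt_top (by rw [Real.volume_Ioo]; exact ENNReal.ofReal_lt_top) measure_ball_lt_top
      -- essential boundedness on the box: its closure is a compact set of regular points
      have hKc : IsCompact (Icc a b ×ˢ closedBall (0 : EuclideanSpace ℝ (Fin 3)) R) :=
        isCompact_Icc.prod (isCompact_closedBall _ _)
      have hKreg : ∀ z ∈ Icc a b ×ˢ closedBall (0 : EuclideanSpace ℝ (Fin 3)) R, IsRegularPoint u z := by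
        rintro ⟨s, y⟩ ⟨hs, -⟩
        exact hreg s ⟨ha.trans_le hs.1, hs.2.trans_lt hb⟩ y
      obtain ⟨U, -, hKU, M, hM⟩ := exists_isOpen_ae_bound_of_forall_isRegularPoint hKc hKreg
      have hMn : ∀ᵐ z ∂(volume.restrict ((Qn n : Opens (ℝ × EuclideanSpace ℝ (Fin 3))) :
          Set (ℝ × EuclideanSpace ℝ (Fin 3)))), ‖u z.1 z.2‖ ≤ M := by
        rw [hQ]
        exact ae_restrict_of_ae_restrict_of_subset
          ((Set.prod_mono Ioo_subset_Icc_self ball_subset_closedBall).trans hKU) hM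
      have hpn : ∫⁻ z in ((Qn n : Opens (ℝ × EuclideanSpace ℝ (Fin 3))) : Set (ℝ × EuclideanSpace ℝ (Fin 3))),
          ‖p z.1 z.2‖ₑ ^ (3 / 2 : ℝ) < ∞ :=
        lt_of_le_of_lt (lintegral_mono_set hleT) hpslab
      exact isSuitableWeakSolutionOn_of_bounded hν hNSn hvol hMn hpn
    have h1 := hsuit.timeShift t₀
    rw [sub_self] at h1
    exact h1
  · -- (B.1.4): `π ∈ L^{3/2}((0, T - t₀) × K)`
    intro K hK
    have h1 := setLIntegral_prod_timeShift t₀ t₀ T K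
      (fun z : ℝ × EuclideanSpace ℝ (Fin 3) => ‖p z.1 z.2‖ₑ ^ (3 / 2 : ℝ))
    rw [sub_self] at h1
    rw [h1]
    exact lt_of_le_of_lt (lintegral_mono_set (Set.prod_mono (Ioo_subset_Ioo ht₀.1.le le_rfl)
      (subset_univ K))) hpslab
  · -- slices are measurable
    intro s hs
    exact (hLHT.memLp (t₀ + s) (hIcc hs)).1
  · -- (B.1.4): the every-time unit-ball bound
    refine ⟨(ENNReal.ofReal (2 * VectorCalculus.kineticEnergy u₀)).toNNReal, fun s hs x₁ => ?_⟩
    rw [ENNReal.coe_toNNReal ENNReal.ofReal_ne_top]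
    exact (setLIntegral_le_lintegral _ _).trans (henergy (t₀ + s) (hIcc hs))
  · -- (B.1.4): the weak spatial gradient and its unit-box bound
    obtain ⟨G, hG, -, hGint, -⟩ := hLHT.exists_hasWeakSpatialGradientOn
    have hG' : HasWeakSpatialGradientOn (slab (EuclideanSpace ℝ (Fin 3)) (Ioo t₀ T) isOpen_Ioo) u G :=
      hG.mono (slab_mono (Ioo_subset_Ioo ht₀.1.le le_rfl))
    have h1 := hG'.timeShift t₀
    rw [sub_self] at h1
    refine ⟨fun s y => G (t₀ + s) y, h1, ?_⟩
    refine ⟨(∫⁻ z in Ioo 0 T ×ˢ (univ : Set (EuclideanSpace ℝ (Fin 3))),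
      ENNReal.ofReal (frobeniusNormSq (G z.1 z.2))).toNNReal, fun x₁ => ?_⟩
    rw [ENNReal.coe_toNNReal hGint.ne]
    have h2 := setLIntegral_prod_timeShift t₀ t₀ T (ball x₁ 1)
      (fun z : ℝ × EuclideanSpace ℝ (Fin 3) => ENNReal.ofReal (frobeniusNormSq (G z.1 z.2)))
    rw [sub_self] at h2
    rw [h2]
    exact lintegral_mono_set (Set.prod_mono (Ioo_subset_Ioo ht₀.1.le le_rfl) (subset_univ _))
  · -- (B.1.6): weak continuity on `[0, T - t₀]`
    intro φ hφ
    have hφ2 : MemLp φ 2 volume :=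
      hφ.contDiff.continuous.memLp_of_hasCompactSupport hφ.hasCompactSupport
    have hmaps : MapsTo (fun s : ℝ => t₀ + s) (Icc 0 (T - t₀)) (Ioc 0 T) := fun s hs =>
      ⟨by linarith [hs.1, ht₀.1], by linarith [hs.2]⟩
    exact (hwcI φ hφ2).comp (continuous_const.add continuous_id).continuousOn hmaps
  · -- (B.1.7): the datum `u(t₀)` is attained in `L²_loc` — `t₀` is a regular time
    intro K hK
    -- around each `x`, a ball on which `∫ |u(t₀ + s) - u(t₀)|² → 0`
    have hball : ∀ x : EuclideanSpace ℝ (Fin 3), ∃ ρ : ℝ, 0 < ρ ∧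
        Tendsto (fun s => ∫⁻ y in closedBall x ρ, ‖u (t₀ + s) y - u t₀ y‖ₑ ^ 2) (𝓝 0) (𝓝 0) := by
      intro x
      have hz : ((t₀, x) : ℝ × EuclideanSpace ℝ (Fin 3)) ∈
          ((slab (EuclideanSpace ℝ (Fin 3)) (Ioo 0 T) isOpen_Ioo :
            Opens (ℝ × EuclideanSpace ℝ (Fin 3))) : Set (ℝ × EuclideanSpace ℝ (Fin 3))) :=
        mem_slab.2 ht₀
      obtain ⟨δ, hδ, R, hR, hsub, v, hvc, hvae⟩ :=
        exists_box_continuousOn_ae_eq_of_isRegularPoint hν hNS hpK hz (hreg t₀ ht₀ x)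
      -- the time window lies in `(0, T)`
      have hIsub : Ioo (t₀ - δ) (t₀ + δ) ⊆ Ioo 0 T := fun s hs => by
        have h := hsub (mk_mem_prod hs (mem_ball_self hR))
        exact mem_slab.1 h
      have hwc : ∀ w : EuclideanSpace ℝ (Fin 3) → EuclideanSpace ℝ (Fin 3), MemLp w 2 volume →
          ContinuousOn (fun t => ∫ y, ⟪u t y, w y⟫) (Ioo (t₀ - δ) (t₀ + δ)) := fun w hw =>
        (hwcI w hw).mono (hIsub.trans Ioo_subset_Ioc_self)
      have hloc : ∀ t ∈ Ioo (t₀ - δ) (t₀ + δ), LocallyIntegrable (u t) volume := fun t ht =>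
        (hLHT.memLp t (Ioo_subset_Icc_self (hIsub ht))).locallyIntegrable (by norm_num)
      have hid : ∀ τ ∈ Ioo (t₀ - δ) (t₀ + δ), ∀ᵐ y ∂(volume.restrict (ball x R)), u τ y = v (τ, y) :=
        fun τ hτ => ae_eq_slice_of_weaklyContinuous_of_continuousOn hwc hloc hvc hvae hτ
      have ht₀I : t₀ ∈ Ioo (t₀ - δ) (t₀ + δ) := ⟨by linarith, by linarith⟩
      exact ⟨R / 2, by positivity,
        tendsto_lintegral_closedBall_sub_sq_of_continuousOn hvc hid ht₀I (by linarith)⟩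
    choose ρ hρ hlim using hball
    -- a finite subcover of `K` by the open balls
    obtain ⟨t, ht⟩ := hK.elim_finite_subcover (fun x => ball x (ρ x)) (fun _ => isOpen_ball)
      fun x _ => mem_iUnion.2 ⟨x, mem_ball_self (hρ x)⟩
    have hKsub : K ⊆ ⋃ x ∈ t, closedBall x (ρ x) :=
      ht.trans (iUnion₂_mono fun x _ => ball_subset_closedBall)
    -- `∫_K ≤ Σ ∫_{B̄ᵢ}`, each tending to `0`
    have hlim2 : Tendsto (fun s => ∫⁻ y in K, ‖u (t₀ + s) y - u t₀ y‖ₑ ^ 2) (𝓝 0) (𝓝 0) := by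
      refine ENNReal.tendsto_nhds_zero.2 fun ε hε => ?_
      have hev : ∀ x ∈ t, ∀ᶠ s in 𝓝 (0 : ℝ),
          ∫⁻ y in closedBall x (ρ x), ‖u (t₀ + s) y - u t₀ y‖ₑ ^ 2 ≤ ε / t.card := fun x _ =>
        ENNReal.tendsto_nhds_zero.1 (hlim x) _ (by
          refine ENNReal.div_pos hε.ne' (ENNReal.natCast_ne_top _))
      filter_upwards [(t.eventually_all).2 hev] with s hs
      calc ∫⁻ y in K, ‖u (t₀ + s) y - u t₀ y‖ₑ ^ 2
          ≤ ∫⁻ y in ⋃ x ∈ t, closedBall x (ρ x), ‖u (t₀ + s) y - u t₀ y‖ₑ ^ 2 :=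
            lintegral_mono_set hKsub
        _ ≤ t.card * (ε / t.card) := lintegral_biUnion_finset_le_card_mul t _ _ hs
        _ ≤ ε := ENNReal.mul_div_le
    exact hlim2.mono_left nhdsWithin_le_nhds
  · -- decay at spatial infinity on the strip
    intro R hR
    -- measurability of the translated field on the strip `(0, T - t₀)`
    have hmeasT : AEStronglyMeasurable (uncurry u)
        (volume.restrict (Ioo 0 T ×ˢ (univ : Set (EuclideanSpace ℝ (Fin 3))))) := hLHT.weak.1
    have hq : Measure.QuasiMeasurePreserving (stAffine 1 1 t₀ (0 : EuclideanSpace ℝ (Fin 3)))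
        (volume.restrict (Ioo 0 (T - t₀) ×ˢ (univ : Set (EuclideanSpace ℝ (Fin 3)))))
        (volume.restrict (Ioo 0 T ×ˢ (univ : Set (EuclideanSpace ℝ (Fin 3))))) := by
      refine ⟨measurable_stAffine _ _ _ _, ?_⟩
      have hmap := map_stAffine_volume_restrict_preimage one_pos one_pos t₀
        (0 : EuclideanSpace ℝ (Fin 3)) (Ioo t₀ T ×ˢ (univ : Set (EuclideanSpace ℝ (Fin 3))))
      rw [stAffine_one_one_preimage_prod, sub_self] at hmap
      rw [hmap]
      exact Measure.smul_absolutelyContinuous.trans (Measure.absolutelyContinuous_of_le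
        (Measure.restrict_mono (Set.prod_mono (Ioo_subset_Ioo ht₀.1.le le_rfl) Subset.rfl) le_rfl))
    have hmeas : AEStronglyMeasurable (uncurry fun s => u (t₀ + s))
        (volume.restrict (Ioo 0 (T - t₀) ×ˢ (univ : Set (EuclideanSpace ℝ (Fin 3))))) := by
      have h1 := hmeasT.comp_quasiMeasurePreserving hq
      have e : uncurry u ∘ stAffine 1 1 t₀ (0 : EuclideanSpace ℝ (Fin 3)) =
          uncurry fun s => u (t₀ + s) := by
        funext z
        simp only [Function.comp_apply, stAffine, one_mul, one_smul, zero_add, uncurry]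
      rw [e] at h1
      exact h1
    -- every-time unit-ball bound and slicewise decay
    have hC : ∀ s ∈ Ioo 0 (T - t₀), ∀ x₀ : EuclideanSpace ℝ (Fin 3),
        ∫⁻ y in ball x₀ 1, ‖(fun s => u (t₀ + s)) s y‖ₑ ^ 2 ≤
          (ENNReal.ofReal (2 * VectorCalculus.kineticEnergy u₀)).toNNReal := by
      intro s hs x₀
      rw [ENNReal.coe_toNNReal ENNReal.ofReal_ne_top]
      exact (setLIntegral_le_lintegral _ _).trans (henergy (t₀ + s) (hIcc (Ioo_subset_Icc_self hs)))
    have hdec : ∀ᵐ s ∂(volume.restrict (Ioo (0 : ℝ) (T - t₀))),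
        Tendsto (fun x₀ : EuclideanSpace ℝ (Fin 3) => ∫⁻ y in ball x₀ 1, ‖(fun s => u (t₀ + s)) s y‖ₑ ^ 2)
          (cocompact (EuclideanSpace ℝ (Fin 3))) (𝓝 0) := by
      refine (ae_restrict_mem measurableSet_Ioo).mono fun s hs => ?_
      have hfin : ∫⁻ y, ‖u (t₀ + s) y‖ₑ ^ 2 ≠ ∞ :=
        ((henergy (t₀ + s) (hIcc (Ioo_subset_Icc_self hs))).trans_lt ENNReal.ofReal_lt_top).ne
      exact tendsto_setLIntegral_ball_cocompact hfin 1
    exact tendsto_lintegral_prod_ball_cocompact_of_slices hmeas hC hdec R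

/-! ### Seregin's rescaling (2.3): the restarted solution, rescaled about `(T, x₀)` and
normalised to unit viscosity -/

/-- **Seregin's approximants** (Seregin 2012, §2, (2.3)–(2.4): "`u^{(k)}(y,s) = λ_k v(x,t)`,
`p^{(k)}(y,s) = λ_k² q(x,t)`, `x = λ_k y`, `t = T + λ_k² s`"; here started at the time `t₀`
instead of `T - λ²S`, centred at `x₀`, and with the viscosity normalised to `1`). For a
Leray–Hopf solution `u` on `[0, T)` with viscosity `ν`, regular on the open strip, `t₀ ∈ (0, T)`,
`λ > 0` and `x₀ ∈ ℝ³`, the field `(s, y) ↦ (λ/ν) u(t₀ + (λ²/ν)s, x₀ + λy)` is, with a suitable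
pressure, a local energy solution with unit viscosity on `ℝ³ × (0, ν(T - t₀)/λ²)` — a strip
ending exactly at the (rescaled) final time `T` — with datum `y ↦ (λ/ν) u(t₀, x₀ + λy)`
(`IsLerayHopfOn.exists_isLocalEnergySolutionOn_restart` and the covariance
`IsLocalEnergySolutionOn.stRescale` with `α = λ/ν`, `β = λ²/ν`, `γ = λ`).
[cite: Seregin2012CMP, §2 (2.3)–(2.4)] -/
theorem IsLerayHopfOn.exists_isLocalEnergySolutionOn_rescaled_restart {ν T : ℝ} (hν : 0 < ν)
    (hT : 0 < T) {u₀ : EuclideanSpace ℝ (Fin 3) → EuclideanSpace ℝ (Fin 3)}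
    {u : ℝ → EuclideanSpace ℝ (Fin 3) → EuclideanSpace ℝ (Fin 3)}
    (hLHT : IsLerayHopfOn T ν 0 u₀ u)
    (hreg : ∀ t ∈ Ioo 0 T, ∀ x : EuclideanSpace ℝ (Fin 3), IsRegularPoint u (t, x))
    {t₀ : ℝ} (ht₀ : t₀ ∈ Ioo 0 T) {lam : ℝ} (hlam : 0 < lam) (x₀ : EuclideanSpace ℝ (Fin 3)) :
    ∃ π : ℝ → EuclideanSpace ℝ (Fin 3) → ℝ,
      IsLocalEnergySolutionOn (ν * (T - t₀) / lam ^ 2) 1 (fun y => (lam / ν) • u t₀ (x₀ + lam • y))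
        (fun s y => (lam / ν) • u (t₀ + lam ^ 2 / ν * s) (x₀ + lam • y)) π := by
  obtain ⟨π₀, h₀⟩ := hLHT.exists_isLocalEnergySolutionOn_restart hν hT hreg ht₀
  have h := h₀.stRescale (α := lam / ν) (β := lam ^ 2 / ν) (γ := lam) (by positivity) hlam
    (by field_simp) x₀
  have e1 : (T - t₀) / (lam ^ 2 / ν) = ν * (T - t₀) / lam ^ 2 := by
    field_simp
  have e2 : lam / ν * ν / lam = 1 := by
    field_simp
  have e3 : ((lam / ν) • stPull (lam ^ 2 / ν) lam 0 x₀ fun s => u (t₀ + s)) =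
      fun s y => (lam / ν) • u (t₀ + lam ^ 2 / ν * s) (x₀ + lam • y) := by
    funext s y
    rw [smul_stPull_apply, zero_add]
  rw [e1, e2, e3] at h
  exact ⟨_, h⟩

/-- **"By the scale invariance of `L₃`-norm, `u^{(k)}(·,−S)` is uniformly bounded in `L₃`"**
(Seregin 2012, §2, (2.4)): `‖(λ/ν) f(x₀ + λ·)‖₃ = ν⁻¹ ‖f‖₃` (`λ > 0`; the Jacobian `λ³` of the
dilation against the cube of the prefactor, and translation invariance).
[cite: Seregin2012CMP, §2 (2.4)] -/
theorem eLpNorm_three_smul_comp_affine (f : EuclideanSpace ℝ (Fin 3) → EuclideanSpace ℝ (Fin 3))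
    {ν lam : ℝ} (hν : 0 < ν) (hlam : 0 < lam) (x₀ : EuclideanSpace ℝ (Fin 3)) :
    eLpNorm (fun y => (lam / ν) • f (x₀ + lam • y)) 3 volume = ENNReal.ofReal ν⁻¹ * eLpNorm f 3 volume := by
  have e : (fun y => (lam / ν) • f (x₀ + lam • y)) = ν⁻¹ • rescaleData lam (fun z => f (x₀ + z)) := by
    funext y
    simp only [Pi.smul_apply, rescaleData, smul_smul]
    rw [div_eq_inv_mul]
  rw [e, eLpNorm_const_smul, eLpNorm_three_rescaleData _ hlam, Real.enorm_eq_ofReal (inv_nonneg.2 hν.le)]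
  congr 1
  have hme : MeasurableEmbedding (fun z : EuclideanSpace ℝ (Fin 3) => x₀ + z) :=
    (MeasurableEquiv.addLeft x₀).measurableEmbedding
  rw [show (fun z => f (x₀ + z)) = f ∘ fun z : EuclideanSpace ℝ (Fin 3) => x₀ + z from rfl,
    ← hme.eLpNorm_map_measure, map_add_left_eq_self]

/-- `L³` membership of the rescaled datum. [folklore] -/
theorem memLp_three_smul_comp_affine {f : EuclideanSpace ℝ (Fin 3) → EuclideanSpace ℝ (Fin 3)}
    (hf : MemLp f 3 volume) {ν lam : ℝ} (hν : 0 < ν) (hlam : 0 < lam) (x₀ : EuclideanSpace ℝ (Fin 3)) :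
    MemLp (fun y => (lam / ν) • f (x₀ + lam • y)) 3 volume := by
  refine ⟨?_, ?_⟩
  · have hq : Measure.QuasiMeasurePreserving (fun y : EuclideanSpace ℝ (Fin 3) => x₀ + lam • y)
        volume volume := by
      refine ⟨by fun_prop, ?_⟩
      rw [map_space_affine_volume hlam x₀]
      exact Measure.smul_absolutelyContinuous
    exact (hf.1.comp_quasiMeasurePreserving hq).const_smul (lam / ν)
  · rw [eLpNorm_three_smul_comp_affine f hν hlam x₀]
    exact ENNReal.mul_lt_top ENNReal.ofReal_lt_top hf.eLpNorm_lt_top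

/-! ### Uniform local energy bounds from the `L³` bound on the data (Seregin 2012, §2,
(2.12)–(2.13); here by Jia–Šverák's slab a priori estimate) -/

/-- **Uniform local energy control of local energy solutions with data bounded in `L³`, on a
short strip** (the role of Seregin 2012, §2, (2.5)–(2.13): "our aim is to show that, for a
suitable choice of `−S`, we can prove uniform estimates … `α(s) ≤ 1/10` for any
`s ∈ ]−S(M), 0[`"; obtained here from the tree's slab form of Jia–Šverák's a priori estimate,
`apriori_unit_scale_slab` (Jia–Šverák 2014, Lemma 3.1 at `R = 1`), the datum bound
`∫_{B(x₀,1)} |a|² ≤ 2‖a‖₃²` (Hölder), and the passage from a.e. to every time `t < T` by the weak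
continuity of Seregin's class (`IsLocalEnergySolutionOn.lintegral_ball_le_of_ae`)). There are
`S₀(M) ∈ (0, 1]` and `B(M)` such that every local energy solution `(v, π)` with unit viscosity on
`ℝ³ × (0, T)`, `T ≤ S₀(M)`, whose datum `a ∈ L³` has `‖a‖₃ ≤ M`, satisfies
`∫_{B(x₀,1)} |v(t)|² ≤ B(M)` for a.e. `t ∈ (0,T)` and for every `t ∈ [0, T)`, and has a weak
spatial gradient `G` with `∫₀ᵀ∫_{B(x₀,1)} |G|² ≤ B(M)`, for every `x₀`.
[cite: Seregin2012CMP, §2 (2.12)–(2.13)] [cite: JiaSverak2014, Lemma 3.1 (arXiv:1204.0529 p. 7)] -/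
theorem exists_localEnergy_bounds_of_L3_data :
    ∃ S₀ : ℝ≥0 → ℝ, ∃ B : ℝ≥0 → ℝ≥0, (∀ M, 0 < S₀ M) ∧ (∀ M, S₀ M ≤ 1) ∧
      ∀ (M : ℝ≥0) (T : ℝ) (a : EuclideanSpace ℝ (Fin 3) → EuclideanSpace ℝ (Fin 3))
        (v : ℝ → EuclideanSpace ℝ (Fin 3) → EuclideanSpace ℝ (Fin 3))
        (π : ℝ → EuclideanSpace ℝ (Fin 3) → ℝ),
        0 < T → T ≤ S₀ M → MemLp a 3 volume → eLpNorm a 3 volume ≤ M →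
        IsLocalEnergySolutionOn T 1 a v π →
        (∀ᵐ t ∂(volume.restrict (Ioo 0 T)), ∀ x₀ : EuclideanSpace ℝ (Fin 3),
            ∫⁻ x in ball x₀ 1, ‖v t x‖ₑ ^ 2 ≤ B M) ∧
        (∀ t ∈ Ico 0 T, ∀ x₀ : EuclideanSpace ℝ (Fin 3), ∫⁻ x in ball x₀ 1, ‖v t x‖ₑ ^ 2 ≤ B M) ∧
        ∃ G : ℝ → EuclideanSpace ℝ (Fin 3) → EuclideanSpace ℝ (Fin 3) →L[ℝ] EuclideanSpace ℝ (Fin 3),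
          HasWeakSpatialGradientOn (slab (EuclideanSpace ℝ (Fin 3)) (Ioo 0 T) isOpen_Ioo) v G ∧
          ∀ x₀ : EuclideanSpace ℝ (Fin 3),
            ∫⁻ z in Ioo 0 T ×ˢ ball x₀ 1, ENNReal.ofReal (frobeniusNormSq (G z.1 z.2)) ≤ B M := by
  obtain ⟨ε₀, hε₀, hε₀1, C, H⟩ := JiaSverak2014.apriori_unit_scale_slab
  refine ⟨fun M => (ε₀ : ℝ) / max 1 ((M : ℝ) ^ 4), fun M => 2 * (C * M ^ 2), fun M => by positivity,
    fun M => ?_, ?_⟩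
  · calc (ε₀ : ℝ) / max 1 ((M : ℝ) ^ 4) ≤ ε₀ := div_le_self ε₀.coe_nonneg (le_max_left _ _)
      _ ≤ 1 := by exact_mod_cast hε₀1
  intro M T a v π hT hTS ha haM hv
  -- the weak spatial gradient of the class
  obtain ⟨G, hG, -⟩ := hv.uniformLocalGradient
  -- the datum bound `∫_{B(x₀,1)} |a|² ≤ 2 M²`
  have hαM : (eLpNorm a 3 volume).toNNReal ≤ M := by
    rw [← ENNReal.coe_le_coe, ENNReal.coe_toNNReal ha.eLpNorm_ne_top]
    exact haM
  have hdat : ∀ x₀ : EuclideanSpace ℝ (Fin 3), ∫⁻ x in ball x₀ 1, ‖a x‖ₑ ^ 2 ≤ 2 * ((M ^ 2 : ℝ≥0) : ℝ≥0∞) := by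
    intro x₀
    refine (lintegral_ball_enorm_sq_le_two_mul ha x₀ zero_le_one).trans ?_
    gcongr
    rw [Real.toNNReal_one, mul_one]
    exact pow_le_pow_left' hαM 2
  -- smallness of the strip
  have hmax : (1 : ℝ) ≤ max 1 ((M : ℝ) ^ 4) := le_max_left _ _
  have hTε : T ≤ (ε₀ : ℝ) := hTS.trans (div_le_self ε₀.coe_nonneg hmax)
  have hTα : T * ((M ^ 2 : ℝ≥0) : ℝ) ^ 2 ≤ (ε₀ : ℝ) := by
    have hM4 : ((M : ℝ) ^ 4) ≤ max 1 ((M : ℝ) ^ 4) := le_max_right _ _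
    calc T * ((M ^ 2 : ℝ≥0) : ℝ) ^ 2 = T * (M : ℝ) ^ 4 := by push_cast; ring
      _ ≤ (ε₀ : ℝ) / max 1 ((M : ℝ) ^ 4) * max 1 ((M : ℝ) ^ 4) := by
          gcongr
      _ = ε₀ := div_mul_cancel₀ _ (by positivity)
  obtain ⟨hE, hD, -⟩ := H a v π G (M ^ 2) T T ha.1 hv.isLocalLeraySolutionOn hG hdat hT le_rfl hTε hTα
  have hB : (2 : ℝ≥0∞) * ((C * M ^ 2 : ℝ≥0) : ℝ≥0∞) = ((2 * (C * M ^ 2) : ℝ≥0) : ℝ≥0∞) := by push_cast; ring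
  refine ⟨?_, ?_, G, hG, fun x₀ => (hD x₀).trans ?_⟩
  · rw [← hB]; exact hE
  · intro t ht x₀
    have hae : ∀ᵐ s ∂(volume : Measure ℝ), s ∈ Ioo t T → ∫⁻ x in ball x₀ 1, ‖v s x‖ₑ ^ 2 ≤
        ((2 * (C * M ^ 2) : ℝ≥0) : ℝ≥0∞) := by
      have h1 := (ae_restrict_iff' (measurableSet_Ioo (a := (0 : ℝ)) (b := T))).1 hE
      filter_upwards [h1] with s hs hst
      rw [← hB]
      exact hs ⟨ht.1.trans_lt hst.1, hst.2⟩ x₀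
    exact hv.lintegral_ball_le_of_ae ⟨ht.1, ht.2.le⟩ ht.2 le_rfl x₀ hae
  · rw [← hB]
    calc ((C * M ^ 2 : ℝ≥0) : ℝ≥0∞) = 1 * ((C * M ^ 2 : ℝ≥0) : ℝ≥0∞) := (one_mul _).symm
      _ ≤ 2 * ((C * M ^ 2 : ℝ≥0) : ℝ≥0∞) := by gcongr; norm_num

/-! ### Back to the original solution: cylinders about `(T, x₀)` (Seregin 2012, §3, "Using the
inverse scaling") -/

/-- **Boundedness of an approximant near the final time is boundedness of `u` near `(T, x₀)`**
(Seregin 2012, §3, p. 5: "Using the inverse scaling, we observe that …"; the map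
`(s, y) ↦ (t₀ + (λ²/ν)s, x₀ + λy)` sends `Q_r(S, 0)` onto the box
`(t₀ + (λ²/ν)S − (λ²/ν)r², t₀ + (λ²/ν)S) × B(x₀, λr)`, which contains the parabolic cylinder of
radius `λr / max(1, √ν)` about `(t₀ + (λ²/ν)S, x₀)`). [cite: Seregin2012CMP, §3 p. 5] -/
theorem eLpNorm_top_parabolicCylinder_lt_top_of_rescaled
    (u : ℝ → EuclideanSpace ℝ (Fin 3) → EuclideanSpace ℝ (Fin 3)) {ν lam : ℝ} (hν : 0 < ν)
    (hlam : 0 < lam) (t₀ S : ℝ) (x₀ : EuclideanSpace ℝ (Fin 3)) {r : ℝ} (hr : 0 < r)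
    (h : eLpNorm (uncurry fun s y => (lam / ν) • u (t₀ + lam ^ 2 / ν * s) (x₀ + lam • y)) ∞
      (volume.restrict (parabolicCylinder r ((S : ℝ), (0 : EuclideanSpace ℝ (Fin 3))))) < ∞) :
    eLpNorm (uncurry u) ∞ (volume.restrict (parabolicCylinder (lam * r / max 1 (Real.sqrt ν))
      ((t₀ + lam ^ 2 / ν * S : ℝ), x₀))) < ∞ := by
  have hβ : 0 < lam ^ 2 / ν := by positivity
  -- the box `A`, image of `Q_r(S, 0)`
  have hpre : stAffine (lam ^ 2 / ν) lam t₀ x₀ ⁻¹'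
      (Ioo (t₀ + lam ^ 2 / ν * S - lam ^ 2 / ν * r ^ 2) (t₀ + lam ^ 2 / ν * S) ×ˢ ball x₀ (lam * r)) =
      parabolicCylinder r ((S : ℝ), (0 : EuclideanSpace ℝ (Fin 3))) := by
    rw [stAffine_preimage_cylinder hβ hlam, parabolicCylinder]
    congr 2
    · field_simp
      ring
    · field_simp
      ring
    · rw [sub_self, smul_zero]
    · field_simp
  -- `u` on `A` is `(ν/λ)` times the approximant on `Q_r(S, 0)`
  have hcomp : uncurry u ∘ stAffine (lam ^ 2 / ν) lam t₀ x₀ =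
      (ν / lam) • uncurry fun s y => (lam / ν) • u (t₀ + lam ^ 2 / ν * s) (x₀ + lam • y) := by
    funext z
    simp only [Function.comp_apply, stAffine, uncurry, Pi.smul_apply, smul_smul]
    rw [show ν / lam * (lam / ν) = 1 by field_simp, one_smul]
  have hA : eLpNorm (uncurry u) ∞ (volume.restrict
      (Ioo (t₀ + lam ^ 2 / ν * S - lam ^ 2 / ν * r ^ 2) (t₀ + lam ^ 2 / ν * S) ×ˢ ball x₀ (lam * r))) < ∞ := by
    rw [← eLpNorm_top_comp_stAffine_restrict_preimage hβ hlam t₀ x₀ (uncurry u), hpre, hcomp,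
      eLpNorm_const_smul]
    exact ENNReal.mul_lt_top enorm_lt_top h
  -- the parabolic cylinder of radius `ρ = λr / max(1, √ν)` about `(t₀ + (λ²/ν)S, x₀)` lies in `A`
  have hm1 : (1 : ℝ) ≤ max 1 (Real.sqrt ν) := le_max_left _ _
  have hmν : ν ≤ (max 1 (Real.sqrt ν)) ^ 2 := by
    calc ν = Real.sqrt ν ^ 2 := (Real.sq_sqrt hν.le).symm
      _ ≤ (max 1 (Real.sqrt ν)) ^ 2 := pow_le_pow_left₀ (Real.sqrt_nonneg _) (le_max_right _ _) 2
  have hρ1 : lam * r / max 1 (Real.sqrt ν) ≤ lam * r := div_le_self (by positivity) hm1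
  have hρ2 : (lam * r / max 1 (Real.sqrt ν)) ^ 2 ≤ lam ^ 2 / ν * r ^ 2 := by
    rw [div_pow, div_le_iff₀ (by positivity)]
    calc (lam * r) ^ 2 = lam ^ 2 / ν * r ^ 2 * ν := by field_simp
      _ ≤ lam ^ 2 / ν * r ^ 2 * (max 1 (Real.sqrt ν)) ^ 2 := by gcongr
  have hsub : parabolicCylinder (lam * r / max 1 (Real.sqrt ν)) ((t₀ + lam ^ 2 / ν * S : ℝ), x₀) ⊆
      Ioo (t₀ + lam ^ 2 / ν * S - lam ^ 2 / ν * r ^ 2) (t₀ + lam ^ 2 / ν * S) ×ˢ ball x₀ (lam * r) := by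
    intro z hz
    rw [parabolicCylinder, mem_prod, mem_Ioo] at hz
    exact ⟨⟨by linarith [hz.1.1], hz.1.2⟩, ball_subset_ball hρ1 hz.2⟩
  exact lt_of_le_of_lt (eLpNorm_mono_measure _ (Measure.restrict_mono hsub le_rfl)) hA

end Literature.Analysis.FluidPDE

end
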